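import Mathlib.Algebra.Order.Archimedean.Real.Basic
import Mathlib.Data.Set.Finite.Lattice
import Mathlib.Order.ConditionallyCompleteLattice.Finset
import Mathlib.Tactic.Linarith
import Mathlib.Tactic.FieldSimp
import Mathlib.Tactic.Positivity
import HarnessLib

/-!
# Barrier (Schanuel): Roy 1992, Theorem 3 — four equivalent statements in an admissible category

Fourth companion on the chain behind the named fact
`Literature.Barriers.Schanuel.roy1992_strongSixExponentials` (Roy 1992, §4 Corollary 2), on the
layer **Theorem 1 (M. Waldschmidt) ⇒ Theorem 2** ([Roy1992], §§2–3): the two theorems are the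
named facts `roy1992_thm1`, `roy1992_thm2` of
`Literature.Barriers.Schanuel.AlgebraicIndependenceOfLogarithmsRoyThm12`. Roy deduces Theorem 2
from Theorem 1 through an abstract combinatorial result, **Theorem 3** (§3, pp. 29–32), about
five functions `a, b, c, d, r : Ob(𝒞) → ℕ` on an "admissible category" (one in which every kernel
admits a cokernel and every cokernel admits a kernel, Proposition 1): four statements about
ratios of these functions are equivalent, the implications `1 ⇒ 2 ⇒ 1'` being proved directly and
`1' ⇒ 2' ⇒ 1` by passing to the opposite category. This file proves Theorem 3 in exactly that
form; the concrete category of §2 and the deduction of Theorem 2 are in the next companions.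

## What the source prints [Roy1992, §3]

* (p. 29) "We say that `𝒞` is admissible if it satisfies the statement of Proposition 1"
  (p. 27: "Any kernel of `𝒞` admits a cokernel in `𝒞` and, vice versa, any cokernel of `𝒞`
  admits a kernel in `𝒞`. The set of all kernels of `𝒞` and the set of its cokernels are closed
  under composition."); (p. 27) "`f : Ob(𝒞) → ℕ` is additive (resp. lower additive, resp. upper
  additive) if it satisfies `f(X) = f(X*) + f(X')` (resp. `≤`, resp. `≥`) for each triple
  `(X*, X, X')` of objects of `𝒞` for which there exists a kernel from `X*` to `X` which admits as
  cokernel a morphism from `X` to `X'`."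
* **Theorem 3.** "Let `𝒞` be an admissible category, and let `a, b, c, d, r` be functions
  defined on `Ob(𝒞)` taking values in `ℕ`. Assume that `a` and `d` are upper additive, that
  `b, c`, and `r` are additive, and that `a, b, c, d` vanish on each object on which `r`
  vanishes. Then the following statements are equivalent:
  Statement 1. For each object `X` of `𝒞` such that `b(X) ≠ 0`, there exists a cokernel
  `s : X → X'` with domain `X` satisfying `b(X') + d(X') ≠ 0` and
  `(a(X') + c(X'))/(b(X') + d(X')) ≤ a(X)/b(X)`.
  Statement 2. Let `X` be an object of `𝒞`. Assume that `b(X) ≠ 0`, `c(X) ≠ 0`, and that, for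
  each kernel `i : X* → X` with codomain `X`, with `c(X*) ≠ 0`, we have
  `d(X)/c(X) ≤ d(X*)/c(X*)`. Assume also that there does not exist a cokernel `s : X → X'` with
  domain `X` such that `c(X') = d(X') = 0` and `r(X') ≠ 0`. Then we have `a(X) ≠ 0` and
  `d(X)/c(X) ≥ b(X)/a(X)`.
  Statement 1'. For each object `X` of `𝒞` such that `c(X) ≠ 0`, there exists a kernel
  `i : X* → X` with codomain `X` satisfying `a(X*) + c(X*) ≠ 0` and
  `(b(X*) + d(X*))/(a(X*) + c(X*)) ≤ d(X)/c(X)`.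
  Statement 2'. Let `X` be an object of `𝒞`. Assume that `b(X) ≠ 0`, `c(X) ≠ 0`, and that, for
  each cokernel `s : X → X'` with domain `X`, with `b(X') ≠ 0`, we have `a(X)/b(X) ≤ a(X')/b(X')`.
  Assume also that there does not exist a kernel `i : X* → X` with codomain `X` such that
  `a(X*) = b(X*) = 0` and `r(X*) ≠ 0`. Then we have `d(X) ≠ 0` and `a(X)/b(X) ≥ c(X)/d(X)`."
* Proof (pp. 30–32): `1 ⇒ 2` and `2 ⇒ 1'` directly; then "Consider the opposite category
  `𝒞ᵒᵖ` … the kernels of `𝒞` become the cokernels of `𝒞ᵒᵖ`, and its cokernels become the kernels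
  of `𝒞ᵒᵖ`. This category is thus admissible, and the additive, lower additive, and upper additive
  functions from `Ob(𝒞)` to `ℕ` remain so … The chain of implications `1 ⇒ 2 ⇒ 1'` proved above
  thus applies also to the family `(𝒞ᵒᵖ, d, c, b, a, r)` instead of `(𝒞, a, b, c, d, r)`."

## Lean rendering

Theorem 3 never uses the morphisms themselves, only: which pairs of objects are joined by a
kernel / a cokernel, which triples `(X*, X, X')` are "exact" (a kernel `X* → X` admitting a
cokernel `X → X'`), identities, composition, and admissibility. `Roy1992.AdmissibleCat Obj`
records exactly this arrow-free shadow of an admissible category (`IsKer`, `IsCoker`, `Exact` and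
the seven closure properties); `AdmissibleCat.op` is the opposite category (`op_op : 𝒞.op.op = 𝒞`
by `rfl`). `Additive` / `UpperAdditive` are as printed; `Thm3Hyp 𝒞 a b c d r` bundles the
hypotheses of Theorem 3 (self-dual: `Thm3Hyp.op`). `Statement1`, `Statement2` are as printed, with
ratios in `ℝ`; `Statement1'`, `Statement2'` are *defined* as the duals
(`Statement1 𝒞.op d c b a r`, `Statement2 𝒞.op d c b a r`) and unfolded to the printed form by
`statement1'_iff`, `statement2'_iff`. Theorems: `statement2_of_statement1`,
`statement1'_of_statement2` (the printed proofs), `statement2'_of_statement1'`,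
`statement1_of_statement2'` (duality), and the cycle `roy1992_thm3`.

## References

* [Roy1992] D. Roy, *Matrices whose coefficients are linear forms in logarithms*, J. Number
  Theory 41 (1992) 22–47: §2 (Proposition 1, additive functions, p. 27); §3 Theorem 3 and its
  proof (pp. 29–32).
-/

noncomputable section

namespace Literature.Barriers.Schanuel.Roy1992

/-! ### Admissible categories, arrow-free -/

/-- **Roy's admissible category, arrow-free.** The data Theorem 3 uses about a category with
kernels and cokernels: `IsKer A X` — there is a kernel `A → X`; `IsCoker X B` — there is a
cokernel `X → B`; `Exact A X B` — there is a kernel `A → X` admitting as cokernel a morphism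
`X → B`; identities are kernels and cokernels, kernels (cokernels) are closed under composition,
and the category is *admissible*: "any kernel of `𝒞` admits a cokernel in `𝒞` and, vice versa,
any cokernel of `𝒞` admits a kernel in `𝒞`". [cite: Roy1992, §2 Proposition 1 (p. 27) and §3 (p. 29)] -/
structure AdmissibleCat (Obj : Type*) where
  /-- there is a kernel from `A` to `X` -/
  IsKer : Obj → Obj → Prop
  /-- there is a cokernel from `X` to `B` -/
  IsCoker : Obj → Obj → Prop
  /-- `(A, X, B)`: a kernel `A → X` admitting as cokernel a morphism `X → B` -/
  Exact : Obj → Obj → Obj → Prop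
  isKer_refl : ∀ X, IsKer X X
  isCoker_refl : ∀ X, IsCoker X X
  isKer_trans : ∀ {A B C : Obj}, IsKer A B → IsKer B C → IsKer A C
  isCoker_trans : ∀ {A B C : Obj}, IsCoker A B → IsCoker B C → IsCoker A C
  isKer_of_exact : ∀ {A X B : Obj}, Exact A X B → IsKer A X
  isCoker_of_exact : ∀ {A X B : Obj}, Exact A X B → IsCoker X B
  exists_exact_of_isKer : ∀ {A X : Obj}, IsKer A X → ∃ B, Exact A X B
  exists_exact_of_isCoker : ∀ {X B : Obj}, IsCoker X B → ∃ A, Exact A X B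

namespace AdmissibleCat

variable {Obj : Type*} (𝒞 : AdmissibleCat Obj)

/-- **The opposite category**: "the kernels of `𝒞` become the cokernels of `𝒞ᵒᵖ`, and its
cokernels become the kernels of `𝒞ᵒᵖ`. This category is thus admissible".
[cite: Roy1992, §3 proof of Theorem 3 (p. 32)] -/
def op : AdmissibleCat Obj where
  IsKer A X := 𝒞.IsCoker X A
  IsCoker X B := 𝒞.IsKer B X
  Exact A X B := 𝒞.Exact B X A
  isKer_refl X := 𝒞.isCoker_refl X
  isCoker_refl X := 𝒞.isKer_refl X
  isKer_trans h₁ h₂ := 𝒞.isCoker_trans h₂ h₁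
  isCoker_trans h₁ h₂ := 𝒞.isKer_trans h₂ h₁
  isKer_of_exact h := 𝒞.isCoker_of_exact h
  isCoker_of_exact h := 𝒞.isKer_of_exact h
  exists_exact_of_isKer h := 𝒞.exists_exact_of_isCoker h
  exists_exact_of_isCoker h := 𝒞.exists_exact_of_isKer h

/-- `(𝒞ᵒᵖ)ᵒᵖ = 𝒞`. [folklore] -/
@[simp] theorem op_op : 𝒞.op.op = 𝒞 := rfl

/-- Kernels of `𝒞ᵒᵖ` are the cokernels of `𝒞`. [cite: Roy1992, §3 proof of Theorem 3 (p. 32)] -/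
@[simp] theorem op_isKer (A X : Obj) : 𝒞.op.IsKer A X = 𝒞.IsCoker X A := rfl

/-- Cokernels of `𝒞ᵒᵖ` are the kernels of `𝒞`. [cite: Roy1992, §3 proof of Theorem 3 (p. 32)] -/
@[simp] theorem op_isCoker (X B : Obj) : 𝒞.op.IsCoker X B = 𝒞.IsKer B X := rfl

/-- Exact triples of `𝒞ᵒᵖ` are the reversed exact triples of `𝒞`. [folklore] -/
@[simp] theorem op_exact (A X B : Obj) : 𝒞.op.Exact A X B = 𝒞.Exact B X A := rfl

/-- "`f` is additive if `f(X) = f(X*) + f(X')` for each triple `(X*, X, X')` … for which there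
exists a kernel from `X*` to `X` which admits as cokernel a morphism from `X` to `X'`."
[cite: Roy1992, §2 Definition (p. 27)] -/
def Additive (f : Obj → ℕ) : Prop :=
  ∀ ⦃A X B : Obj⦄, 𝒞.Exact A X B → f X = f A + f B

/-- "`f` is upper additive if `f(X) ≥ f(X*) + f(X')`" for each such triple.
[cite: Roy1992, §2 Definition (p. 27)] -/
def UpperAdditive (f : Obj → ℕ) : Prop :=
  ∀ ⦃A X B : Obj⦄, 𝒞.Exact A X B → f A + f B ≤ f X

variable {𝒞}

/-- Additive functions stay additive on `𝒞ᵒᵖ`. [cite: Roy1992, §3 proof of Theorem 3 (p. 32)] -/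
theorem Additive.op {f : Obj → ℕ} (h : 𝒞.Additive f) : 𝒞.op.Additive f :=
  fun _ _ _ hE => by rw [h hE, add_comm]

/-- Upper additive functions stay upper additive on `𝒞ᵒᵖ`. [cite: Roy1992, §3 proof of Theorem 3 (p. 32)] -/
theorem UpperAdditive.op {f : Obj → ℕ} (h : 𝒞.UpperAdditive f) : 𝒞.op.UpperAdditive f :=
  fun _ _ _ hE => by rw [add_comm]; exact h hE

/-- An additive function does not increase along kernels: `f(X*) ≤ f(X)`. [cite: Roy1992, §3 (p. 30)] -/
theorem Additive.le_of_isKer {f : Obj → ℕ} (h : 𝒞.Additive f) {A X : Obj} (hK : 𝒞.IsKer A X) :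
    f A ≤ f X := by
  obtain ⟨B, hE⟩ := 𝒞.exists_exact_of_isKer hK
  rw [h hE]
  exact Nat.le_add_right _ _

/-- An additive function does not increase along cokernels: `f(X') ≤ f(X)`. [cite: Roy1992, §3 (p. 30)] -/
theorem Additive.le_of_isCoker {f : Obj → ℕ} (h : 𝒞.Additive f) {X B : Obj}
    (hC : 𝒞.IsCoker X B) : f B ≤ f X := by
  obtain ⟨A, hE⟩ := 𝒞.exists_exact_of_isCoker hC
  rw [h hE]
  exact Nat.le_add_left _ _

/-- An upper additive function does not increase along kernels. [cite: Roy1992, §3 (p. 30)] -/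
theorem UpperAdditive.le_of_isKer {f : Obj → ℕ} (h : 𝒞.UpperAdditive f) {A X : Obj}
    (hK : 𝒞.IsKer A X) : f A ≤ f X := by
  obtain ⟨B, hE⟩ := 𝒞.exists_exact_of_isKer hK
  exact le_trans (Nat.le_add_right _ _) (h hE)

/-- An upper additive function does not increase along cokernels. [cite: Roy1992, §3 (p. 30)] -/
theorem UpperAdditive.le_of_isCoker {f : Obj → ℕ} (h : 𝒞.UpperAdditive f) {X B : Obj}
    (hC : 𝒞.IsCoker X B) : f B ≤ f X := by
  obtain ⟨A, hE⟩ := 𝒞.exists_exact_of_isCoker hC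
  exact le_trans (Nat.le_add_left _ _) (h hE)

variable (𝒞)

/-- **The hypotheses of Theorem 3**: "`a` and `d` are upper additive, `b, c`, and `r` are
additive, and `a, b, c, d` vanish on each object on which `r` vanishes."
[cite: Roy1992, §3 Theorem 3 (p. 29)] -/
structure Thm3Hyp (a b c d r : Obj → ℕ) : Prop where
  ha : 𝒞.UpperAdditive a
  hb : 𝒞.Additive b
  hc : 𝒞.Additive c
  hd : 𝒞.UpperAdditive d
  hr : 𝒞.Additive r
  vanish : ∀ X, r X = 0 → a X = 0 ∧ b X = 0 ∧ c X = 0 ∧ d X = 0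

variable {𝒞}

/-- The hypotheses of Theorem 3 for `(𝒞, a, b, c, d, r)` give those for `(𝒞ᵒᵖ, d, c, b, a, r)`.
[cite: Roy1992, §3 proof of Theorem 3 (p. 32)] -/
theorem Thm3Hyp.op {a b c d r : Obj → ℕ} (h : 𝒞.Thm3Hyp a b c d r) : 𝒞.op.Thm3Hyp d c b a r where
  ha := h.hd.op
  hb := h.hc.op
  hc := h.hb.op
  hd := h.ha.op
  hr := h.hr.op
  vanish X hX := by
    obtain ⟨h1, h2, h3, h4⟩ := h.vanish X hX
    exact ⟨h4, h3, h2, h1⟩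

variable (𝒞)

/-! ### The four statements -/

/-- **Statement 1.** "For each object `X` of `𝒞` such that `b(X) ≠ 0`, there exists a cokernel
`s : X → X'` with domain `X` satisfying `b(X') + d(X') ≠ 0` and
`(a(X') + c(X'))/(b(X') + d(X')) ≤ a(X)/b(X)`." [cite: Roy1992, §3 Theorem 3, Statement 1 (p. 29)] -/
def Statement1 (a b c d _r : Obj → ℕ) : Prop :=
  ∀ X, b X ≠ 0 → ∃ X', 𝒞.IsCoker X X' ∧ b X' + d X' ≠ 0 ∧
    ((a X' : ℝ) + c X') / ((b X' : ℝ) + d X') ≤ (a X : ℝ) / b X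

/-- **Statement 2.** "Let `X` be an object of `𝒞`. Assume that `b(X) ≠ 0`, `c(X) ≠ 0`, and that,
for each kernel `i : X* → X` with codomain `X`, with `c(X*) ≠ 0`, we have
`d(X)/c(X) ≤ d(X*)/c(X*)`. Assume also that there does not exist a cokernel `s : X → X'` with
domain `X` such that `c(X') = d(X') = 0` and `r(X') ≠ 0`. Then we have `a(X) ≠ 0` and
`d(X)/c(X) ≥ b(X)/a(X)`." [cite: Roy1992, §3 Theorem 3, Statement 2 (p. 29)] -/
def Statement2 (a b c d r : Obj → ℕ) : Prop :=
  ∀ X, b X ≠ 0 → c X ≠ 0 →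
    (∀ A, 𝒞.IsKer A X → c A ≠ 0 → (d X : ℝ) / c X ≤ (d A : ℝ) / c A) →
    (¬ ∃ X', 𝒞.IsCoker X X' ∧ c X' = 0 ∧ d X' = 0 ∧ r X' ≠ 0) →
    a X ≠ 0 ∧ (b X : ℝ) / a X ≤ (d X : ℝ) / c X

/-- **Statement 1'** — Statement 1 for `(𝒞ᵒᵖ, d, c, b, a, r)`; printed form in `statement1'_iff`.
[cite: Roy1992, §3 Theorem 3, Statement 1' (p. 30)] -/
def Statement1' (a b c d r : Obj → ℕ) : Prop :=
  𝒞.op.Statement1 d c b a r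

/-- **Statement 2'** — Statement 2 for `(𝒞ᵒᵖ, d, c, b, a, r)`; printed form in `statement2'_iff`.
[cite: Roy1992, §3 Theorem 3, Statement 2' (p. 30)] -/
def Statement2' (a b c d r : Obj → ℕ) : Prop :=
  𝒞.op.Statement2 d c b a r

/-- Statement 1' as printed: "For each object `X` of `𝒞` such that `c(X) ≠ 0`, there exists a
kernel `i : X* → X` with codomain `X` satisfying `a(X*) + c(X*) ≠ 0` and
`(b(X*) + d(X*))/(a(X*) + c(X*)) ≤ d(X)/c(X)`." [cite: Roy1992, §3 Theorem 3, Statement 1' (p. 30)] -/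
theorem statement1'_iff (a b c d r : Obj → ℕ) :
    𝒞.Statement1' a b c d r ↔
      ∀ X, c X ≠ 0 → ∃ A, 𝒞.IsKer A X ∧ a A + c A ≠ 0 ∧
        ((b A : ℝ) + d A) / ((a A : ℝ) + c A) ≤ (d X : ℝ) / c X := by
  unfold Statement1' Statement1
  simp only [op_isCoker]
  constructor
  · intro h X hX
    obtain ⟨A, hA, h1, h2⟩ := h X hX
    exact ⟨A, hA, by rwa [add_comm], by rwa [add_comm (b A : ℝ), add_comm (a A : ℝ)]⟩
  · intro h X hX
    obtain ⟨A, hA, h1, h2⟩ := h X hX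
    exact ⟨A, hA, by rwa [add_comm], by rwa [add_comm (d A : ℝ), add_comm (c A : ℝ)]⟩

/-- Statement 2' as printed: "Let `X` be an object of `𝒞`. Assume that `b(X) ≠ 0`, `c(X) ≠ 0`,
and that, for each cokernel `s : X → X'` with domain `X`, with `b(X') ≠ 0`, we have
`a(X)/b(X) ≤ a(X')/b(X')`. Assume also that there does not exist a kernel `i : X* → X` with
codomain `X` such that `a(X*) = b(X*) = 0` and `r(X*) ≠ 0`. Then we have `d(X) ≠ 0` and
`a(X)/b(X) ≥ c(X)/d(X)`." [cite: Roy1992, §3 Theorem 3, Statement 2' (p. 30)] -/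
theorem statement2'_iff (a b c d r : Obj → ℕ) :
    𝒞.Statement2' a b c d r ↔
      ∀ X, b X ≠ 0 → c X ≠ 0 →
        (∀ X', 𝒞.IsCoker X X' → b X' ≠ 0 → (a X : ℝ) / b X ≤ (a X' : ℝ) / b X') →
        (¬ ∃ A, 𝒞.IsKer A X ∧ a A = 0 ∧ b A = 0 ∧ r A ≠ 0) →
        d X ≠ 0 ∧ (c X : ℝ) / d X ≤ (a X : ℝ) / b X := by
  unfold Statement2' Statement2
  simp only [op_isCoker, op_isKer]
  constructor
  · intro h X hb hc hmin hno
    refine h X hc hb hmin ?_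
    rintro ⟨A, hA, h1, h2, h3⟩
    exact hno ⟨A, hA, h2, h1, h3⟩
  · intro h X hc hb hmin hno
    refine h X hb hc hmin ?_
    rintro ⟨A, hA, h1, h2, h3⟩
    exact hno ⟨A, hA, h2, h1, h3⟩

/-! ### Minimisers -/

variable {𝒞}

/-- A ratio `f/g` of natural-number functions bounded on a non-empty class of objects attains its
minimum on that class (the set of its values is finite). [cite: Roy1992, §3 proof of Theorem 3 (p. 30: "This implies that there exists in E a cokernel … for which the ratio … is minimal")] -/
theorem exists_min_ratio (P : Obj → Prop) (f g : Obj → ℕ) (M N : ℕ)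
    (hbd : ∀ A, P A → f A ≤ M ∧ g A ≤ N) {X₀ : Obj} (h₀ : P X₀) :
    ∃ A, P A ∧ ∀ A', P A' → (f A : ℝ) / g A ≤ (f A' : ℝ) / g A' := by
  set S : Set ℝ := {x | ∃ A, P A ∧ x = (f A : ℝ) / g A} with hS
  have hne : S.Nonempty := ⟨_, X₀, h₀, rfl⟩
  have hfin : S.Finite := by
    refine Set.Finite.subset ((Finset.finite_toSet (Finset.range (M + 1) ×ˢ Finset.range (N + 1))).image
      fun p : ℕ × ℕ => (p.1 : ℝ) / (p.2 : ℝ)) ?_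
    rintro x ⟨A, hA, rfl⟩
    refine ⟨(f A, g A), ?_, rfl⟩
    obtain ⟨h1, h2⟩ := hbd A hA
    simp only [Finset.coe_product, Finset.coe_range, Set.mem_prod, Set.mem_Iio]
    omega
  obtain ⟨A, hA, heq⟩ := hne.csInf_mem hfin
  refine ⟨A, hA, fun A' hA' => ?_⟩
  rw [← heq]
  exact csInf_le hfin.bddBelow ⟨A', hA', rfl⟩

/-- A natural-number function attains its minimum on a non-empty class of objects.
[cite: Roy1992, §3 proof of Theorem 3 (p. 31: "Let `i : X* → X` be an element of `E₀` for which `r(X*)` is minimal")] -/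
theorem exists_min_nat (P : Obj → Prop) (r : Obj → ℕ) {X₀ : Obj} (h₀ : P X₀) :
    ∃ A, P A ∧ ∀ A', P A' → r A ≤ r A' := by
  classical
  have hex : ∃ n, ∃ A, P A ∧ r A = n := ⟨r X₀, X₀, h₀, rfl⟩
  obtain ⟨A, hA, hrA⟩ := Nat.find_spec hex
  refine ⟨A, hA, fun A' hA' => ?_⟩
  rw [hrA]
  exact Nat.find_min' hex ⟨A', hA', rfl⟩

/-! ### Theorem 3: `1 ⇒ 2` -/

/-- **Statement 1 ⇒ Statement 2** (printed proof, p. 30–31): minimise `a(X')/b(X')` over the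
cokernels `X → X'` with `b(X') ≠ 0` (the identity is one), apply Statement 1 to a minimiser
`X₁`, getting `X₁ → X₂`; `d(X₂) ≠ 0` (else `c(X₂) = 0 ≠ r(X₂)` against the last assumption),
`c(X₂)/d(X₂) ≤ a(X₁)/b(X₁) ≤ a(X)/b(X)`; with a kernel `X* → X` of the composite `X → X₂`,
additivity of `c`, upper additivity of `d` and the first assumption give
`c(X)/d(X) ≤ c(X₂)/d(X₂)`. [cite: Roy1992, §3 Theorem 3, proof of 1 ⇒ 2 (pp. 30–31)] -/
theorem statement2_of_statement1 {a b c d r : Obj → ℕ} (H : 𝒞.Thm3Hyp a b c d r)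
    (h1 : 𝒞.Statement1 a b c d r) : 𝒞.Statement2 a b c d r := by
  intro X hbX hcX hmin hno
  -- `E` = cokernels `X → X'` with `b(X') ≠ 0`; `X₁` minimises `a/b` on `E`
  set P : Obj → Prop := fun X' => 𝒞.IsCoker X X' ∧ b X' ≠ 0 with hP
  have hPX : P X := ⟨𝒞.isCoker_refl X, hbX⟩
  obtain ⟨X₁, ⟨hX₁C, hbX₁⟩, hX₁min⟩ := exists_min_ratio P a b (a X) (b X)
    (fun A hA => ⟨H.ha.le_of_isCoker hA.1, H.hb.le_of_isCoker hA.1⟩) hPX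
  -- Statement 1 at `X₁`
  obtain ⟨X₂, hX₂C, hbd₂, hineq⟩ := h1 X₁ hbX₁
  have hXX₂ : 𝒞.IsCoker X X₂ := 𝒞.isCoker_trans hX₁C hX₂C
  -- positivity bookkeeping
  have hbX₁pos : (0 : ℝ) < b X₁ := by exact_mod_cast Nat.pos_of_ne_zero hbX₁
  have hbXpos : (0 : ℝ) < b X := by exact_mod_cast Nat.pos_of_ne_zero hbX
  have hcXpos : (0 : ℝ) < c X := by exact_mod_cast Nat.pos_of_ne_zero hcX
  have hbd₂pos : (0 : ℝ) < (b X₂ : ℝ) + d X₂ := by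
    have : 0 < b X₂ + d X₂ := Nat.pos_of_ne_zero hbd₂
    exact_mod_cast this
  set ρ : ℝ := (a X₁ : ℝ) / b X₁ with hρ
  -- (2): if `b(X₂) ≠ 0` then `ρ ≤ a(X₂)/b(X₂)`, i.e. `ρ b(X₂) ≤ a(X₂)` (also true if `b(X₂) = 0`)
  have h2 : ρ * b X₂ ≤ a X₂ := by
    by_cases hb₂ : b X₂ = 0
    · rw [hb₂, Nat.cast_zero, mul_zero]
      positivity
    · have hb₂pos : (0 : ℝ) < b X₂ := by exact_mod_cast Nat.pos_of_ne_zero hb₂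
      have := hX₁min X₂ ⟨hXX₂, hb₂⟩
      rw [le_div_iff₀ hb₂pos] at this
      exact this
  -- (1) cross-multiplied: `a(X₂) + c(X₂) ≤ ρ (b(X₂) + d(X₂))`
  have h1' : (a X₂ : ℝ) + c X₂ ≤ ρ * ((b X₂ : ℝ) + d X₂) := by
    rw [div_le_iff₀ hbd₂pos] at hineq
    exact hineq
  -- hence `c(X₂) ≤ ρ d(X₂)`
  have hcd₂ : (c X₂ : ℝ) ≤ ρ * d X₂ := by nlinarith
  -- `d(X₂) ≠ 0`
  have hdX₂ : d X₂ ≠ 0 := by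
    intro hd₂
    have hc₂ : c X₂ = 0 := by
      have : (c X₂ : ℝ) ≤ 0 := by rw [hd₂, Nat.cast_zero, mul_zero] at hcd₂; exact hcd₂
      exact_mod_cast le_antisymm this (Nat.cast_nonneg _)
    have hr₂ : r X₂ ≠ 0 := by
      intro hr₂
      have hb₂ := (H.vanish X₂ hr₂).2.1
      exact hbd₂ (by rw [hb₂, hd₂])
    exact hno ⟨X₂, hXX₂, hc₂, hd₂, hr₂⟩
  have hdX₂pos : (0 : ℝ) < d X₂ := by exact_mod_cast Nat.pos_of_ne_zero hdX₂
  -- (3): `c(X₂)/d(X₂) ≤ ρ`; (4): `ρ ≤ a(X)/b(X)`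
  have h3 : (c X₂ : ℝ) / d X₂ ≤ ρ := by rw [div_le_iff₀ hdX₂pos]; exact hcd₂
  have h4 : ρ ≤ (a X : ℝ) / b X := hX₁min X hPX
  -- a kernel `X* → X` of `X → X₂`
  obtain ⟨A, hE⟩ := 𝒞.exists_exact_of_isCoker hXX₂
  have hcadd : c X = c A + c X₂ := H.hc hE
  have hdadd : d A + d X₂ ≤ d X := H.hd hE
  have hdX : d X ≠ 0 := by omega
  have hdXpos : (0 : ℝ) < d X := by exact_mod_cast Nat.pos_of_ne_zero hdX
  -- (6): `d(X₂) c(X) ≤ d(X) c(X₂)`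
  have h6 : (d X₂ : ℝ) * c X ≤ (d X : ℝ) * c X₂ := by
    have hcastc : (c X : ℝ) = c A + c X₂ := by exact_mod_cast hcadd
    have hcastd : (d A : ℝ) + d X₂ ≤ d X := by exact_mod_cast hdadd
    by_cases hcA : c A = 0
    · rw [hcA, Nat.cast_zero, zero_add] at hcastc
      rw [hcastc]
      have : (d X₂ : ℝ) ≤ d X := by
        have h0 : (0 : ℝ) ≤ d A := Nat.cast_nonneg _
        linarith
      exact mul_le_mul_of_nonneg_right this (Nat.cast_nonneg _)
    · have hcApos : (0 : ℝ) < c A := by exact_mod_cast Nat.pos_of_ne_zero hcA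
      have h5 := hmin A (𝒞.isKer_of_exact hE) hcA
      rw [div_le_div_iff₀ hcXpos hcApos] at h5
      -- `d X * c A ≤ d A * c X`
      nlinarith [mul_nonneg (Nat.cast_nonneg (d X₂) : (0 : ℝ) ≤ d X₂) hcApos.le]
  have h6' : (c X : ℝ) / d X ≤ (c X₂ : ℝ) / d X₂ := by
    rw [div_le_div_iff₀ hdXpos hdX₂pos]
    linarith
  -- combine: `c(X)/d(X) ≤ a(X)/b(X)`
  have hfinal : (c X : ℝ) / d X ≤ (a X : ℝ) / b X := h6'.trans (h3.trans h4)
  have haX : a X ≠ 0 := by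
    intro ha0
    rw [ha0, Nat.cast_zero, zero_div] at hfinal
    have : (0 : ℝ) < (c X : ℝ) / d X := div_pos hcXpos hdXpos
    linarith
  have haXpos : (0 : ℝ) < a X := by exact_mod_cast Nat.pos_of_ne_zero haX
  refine ⟨haX, ?_⟩
  rw [div_le_div_iff₀ haXpos hcXpos]
  rw [div_le_div_iff₀ hdXpos hbXpos] at hfinal
  linarith

/-! ### Theorem 3: `2 ⇒ 1'` -/

/-- **Statement 2 ⇒ Statement 1'** (printed proof, pp. 31–32): among the kernels `X* → X` with
`c(X*) ≠ 0` minimising `d(X*)/c(X*)`, take one with `r(X*)` minimal; if `b(X*) ≠ 0` it satisfies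
the hypotheses of Statement 2 (a cokernel `X* → X'` with `c(X') = d(X') = 0` has a kernel
`X** → X*` with the same ratio and `r(X**) ≤ r(X*)`, forcing `r(X') = 0`), whence
`b(X*)/a(X*) ≤ d(X*)/c(X*) ≤ d(X)/c(X)` and the mediant inequality; if `b(X*) = 0` the bound is
immediate. [cite: Roy1992, §3 Theorem 3, proof of 2 ⇒ 1' (pp. 31–32)] -/
theorem statement1'_of_statement2 {a b c d r : Obj → ℕ} (H : 𝒞.Thm3Hyp a b c d r)
    (h2 : 𝒞.Statement2 a b c d r) : 𝒞.Statement1' a b c d r := by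
  rw [statement1'_iff]
  intro X hcX
  -- `E` = kernels `A → X` with `c(A) ≠ 0`; `A₀` minimises `d/c`; `E₀` = the minimisers
  set P : Obj → Prop := fun A => 𝒞.IsKer A X ∧ c A ≠ 0 with hP
  have hPX : P X := ⟨𝒞.isKer_refl X, hcX⟩
  obtain ⟨A₀, hA₀, hA₀min⟩ := exists_min_ratio P d c (d X) (c X)
    (fun A hA => ⟨H.hd.le_of_isKer hA.1, H.hc.le_of_isKer hA.1⟩) hPX
  set m : ℝ := (d A₀ : ℝ) / c A₀ with hm
  set P₀ : Obj → Prop := fun A => P A ∧ (d A : ℝ) / c A ≤ m with hP₀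
  have hP₀A₀ : P₀ A₀ := ⟨hA₀, le_rfl⟩
  -- `A` ∈ `E₀` with `r(A)` minimal
  obtain ⟨A, ⟨⟨hAK, hcA⟩, hAm⟩, hArmin⟩ := exists_min_nat P₀ r hP₀A₀
  have hcApos : (0 : ℝ) < c A := by exact_mod_cast Nat.pos_of_ne_zero hcA
  have hcXpos : (0 : ℝ) < c X := by exact_mod_cast Nat.pos_of_ne_zero hcX
  have hAeq : (d A : ℝ) / c A = m := le_antisymm hAm (hA₀min A ⟨hAK, hcA⟩)
  -- (ii) `d(A)/c(A) ≤ d(X)/c(X)`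
  have hii : (d A : ℝ) / c A ≤ (d X : ℝ) / c X := by rw [hAeq]; exact hA₀min X hPX
  refine ⟨A, hAK, by omega, ?_⟩
  have hacpos : (0 : ℝ) < (a A : ℝ) + c A := by positivity
  by_cases hbA : b A = 0
  · -- `b(A) = 0`: `d(A)/(a(A) + c(A)) ≤ d(A)/c(A) ≤ d(X)/c(X)`
    refine le_trans ?_ hii
    rw [hbA, Nat.cast_zero, zero_add, div_le_div_iff₀ hacpos hcApos]
    nlinarith [Nat.cast_nonneg (α := ℝ) (a A), Nat.cast_nonneg (α := ℝ) (d A)]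
  · -- `b(A) ≠ 0`: `A` satisfies the hypotheses of Statement 2
    have hminA : ∀ A', 𝒞.IsKer A' A → c A' ≠ 0 → (d A : ℝ) / c A ≤ (d A' : ℝ) / c A' := by
      intro A' hA'K hcA'
      rw [hAeq]
      exact hA₀min A' ⟨𝒞.isKer_trans hA'K hAK, hcA'⟩
    have hnoA : ¬ ∃ X', 𝒞.IsCoker A X' ∧ c X' = 0 ∧ d X' = 0 ∧ r X' ≠ 0 := by
      rintro ⟨X', hX'C, hcX', hdX', hrX'⟩
      obtain ⟨A'', hE⟩ := 𝒞.exists_exact_of_isCoker hX'C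
      have hc'' : c A = c A'' := by rw [H.hc hE, hcX', add_zero]
      have hd'' : d A'' ≤ d A := by
        have := H.hd hE
        rw [hdX', add_zero] at this
        exact this
      have hA''K : 𝒞.IsKer A'' X := 𝒞.isKer_trans (𝒞.isKer_of_exact hE) hAK
      have hcA'' : c A'' ≠ 0 := by rw [← hc'']; exact hcA
      have hcA''pos : (0 : ℝ) < c A'' := by exact_mod_cast Nat.pos_of_ne_zero hcA''
      have hratio : (d A'' : ℝ) / c A'' ≤ m := by
        rw [← hAeq]
        have hcc : (c A'' : ℝ) = c A := by exact_mod_cast hc''.symm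
        rw [hcc, div_le_div_iff₀ hcApos hcApos]
        have : (d A'' : ℝ) ≤ d A := by exact_mod_cast hd''
        exact mul_le_mul_of_nonneg_right this hcApos.le
      have hrle : r A ≤ r A'' := hArmin A'' ⟨⟨hA''K, hcA''⟩, hratio⟩
      have hradd : r A = r A'' + r X' := H.hr hE
      exact hrX' (by omega)
    obtain ⟨haA, hba⟩ := h2 A hbA hcA hminA hnoA
    have haApos : (0 : ℝ) < a A := by exact_mod_cast Nat.pos_of_ne_zero haA
    -- mediant: `b(A) ≤ (d(A)/c(A)) a(A)` and `d(A) = (d(A)/c(A)) c(A)`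
    refine le_trans ?_ hii
    rw [div_le_div_iff₀ hacpos hcApos]
    rw [div_le_div_iff₀ haApos hcApos] at hba
    nlinarith

/-! ### Duality and the cycle -/

/-- **Statement 1' ⇒ Statement 2'** — `1 ⇒ 2` in the opposite category.
[cite: Roy1992, §3 Theorem 3, proof (p. 32)] -/
theorem statement2'_of_statement1' {a b c d r : Obj → ℕ} (H : 𝒞.Thm3Hyp a b c d r)
    (h : 𝒞.Statement1' a b c d r) : 𝒞.Statement2' a b c d r :=
  statement2_of_statement1 H.op h

/-- **Statement 2' ⇒ Statement 1** — `2 ⇒ 1'` in the opposite category.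
[cite: Roy1992, §3 Theorem 3, proof (p. 32)] -/
theorem statement1_of_statement2' {a b c d r : Obj → ℕ} (H : 𝒞.Thm3Hyp a b c d r)
    (h : 𝒞.Statement2' a b c d r) : 𝒞.Statement1 a b c d r :=
  statement1'_of_statement2 H.op h

/-- **Statement 1 ⇒ Statement 2'** (the implication used for Theorem 2bis: `1 ⇒ 2 ⇒ 1' ⇒ 2'`).
[cite: Roy1992, §3 Theorem 3 and proof of Theorem 2bis (p. 32)] -/
theorem statement2'_of_statement1 {a b c d r : Obj → ℕ} (H : 𝒞.Thm3Hyp a b c d r)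
    (h1 : 𝒞.Statement1 a b c d r) : 𝒞.Statement2' a b c d r :=
  statement2'_of_statement1' H (statement1'_of_statement2 H (statement2_of_statement1 H h1))

/-- **Roy 1992, Theorem 3**: under `Thm3Hyp`, Statements 1, 2, 1', 2' are equivalent (the cycle
`1 ⇒ 2 ⇒ 1' ⇒ 2' ⇒ 1`). [cite: Roy1992, §3 Theorem 3 (pp. 29–32)] -/
theorem roy1992_thm3 {a b c d r : Obj → ℕ} (H : 𝒞.Thm3Hyp a b c d r) :
    (𝒞.Statement1 a b c d r ↔ 𝒞.Statement2 a b c d r) ∧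
      (𝒞.Statement2 a b c d r ↔ 𝒞.Statement1' a b c d r) ∧
      (𝒞.Statement1' a b c d r ↔ 𝒞.Statement2' a b c d r) :=
  ⟨⟨statement2_of_statement1 H, fun h2 =>
      statement1_of_statement2' H (statement2'_of_statement1' H (statement1'_of_statement2 H h2))⟩,
    ⟨statement1'_of_statement2 H, fun h1' =>
      statement2_of_statement1 H (statement1_of_statement2' H (statement2'_of_statement1' H h1'))⟩,
    ⟨statement2'_of_statement1' H, fun h2' =>
      statement1'_of_statement2 H (statement2_of_statement1 H (statement1_of_statement2' H h2'))⟩⟩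

end AdmissibleCat

end Literature.Barriers.Schanuel.Roy1992
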